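import Summits.AnomalousDissipation.AnomalousDissipation.Theses.ImpulseGrid
import Literature.Analysis.FluidPDE.DoeringFoiasPowerProofs
import Literature.Analysis.FluidPDE.LerayHopfMomentum
import Literature.Analysis.FluidPDE.RestartedEnergyBound
import HarnessLib

/-!
# Stub `stub_absorbingBallGrid` of the line `Sketch`
# (crux `ImpulseGrid.BoundedEnergyNoLeakGrid`, stmt-AnomalousDissipation-14350)

Sorry-free discharge of the registered stub `stub_absorbingBallGrid` of the lead's skeleton (v5)
for the crux `ImpulseGrid.BoundedEnergyNoLeakGrid` (line `Sketch`): the **absorbing ball** /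
forward kinetic-energy cap of ONE global Leray–Hopf solution `u` of the Navier–Stokes equations on
`T³` at FIXED viscosity `ν > 0` under a smooth mean-zero steady force `f`:
`∃ C ≥ 0, ∀ t ≥ 0, ½‖u(t)‖₂² ≤ C` (`C` may depend on `ν`, `f`, `u₀`; only uniformity in `t ≥ 0`
matters). This is the qualitative form of Foias–Manley–Rosa–Temam 2001, Ch. II App. A
(A.41)–(A.42) / Ch. IV (3.2), at ANY momentum `∫ u₀`.

Proof (all ingredients in tree, `Literature/Analysis/FluidPDE/LerayHopfMomentum.lean` and
`Literature/Analysis/FluidPDE/RestartedEnergyBound.lean`). With `y(τ) := ∫‖u(τ)‖²` (and `y(0)`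
read as `‖u₀‖₂²`):

* the momentum `m := ∫ u(τ)` is conserved for `τ > 0` (mean-zero force, constant test fields:
  `Torus.IsGlobalLerayHopf.integral_eq_integral_of_hasZeroMean`), so Poincaré with mean
  (`Torus.integral_norm_sq_le_add_toReal_eGradNormSq`) integrates to
  `∫_{(s,t]} y ≤ ∫ₛᵗ‖∇u‖₂² + ‖m‖²(t − s)`;
* the energy inequalities from `0` (`energy_ineq_zero`) and from a.e. `s > 0` (`energy_ineq_ae`),
  processed by Young + Poincaré with mean
  (`Torus.IsGlobalLerayHopf.norm_sq_add_dissipation_le_of_hasZeroMean`: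
  `y(t) + ν∫ₛᵗ‖∇u‖₂² ≤ y(s) + (‖f‖₂²/ν)(t − s)`), give the RESTARTED integral inequality
  `y(t) + ν∫_{(s,t]} y ≤ y(s) + C(t − s)`, `C := ‖f‖₂²/ν + ν‖m‖²`, for `s = 0`, a.e. `s > 0` and
  all `t ≥ s`;
* the real-analysis lemma `exists_forall_le_of_restart` (discrete Grönwall through good times)
  turns it into `∃ R, ∀ t ≥ 0, y(t) ≤ R`; finally `kineticEnergy (u t) = ½ y(t) ≤ max (R/2) 0`
  (`t = 0` via `energy_ineq_zero` at `t = 0`).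

The private theorem `exists_forall_integral_norm_sq_le` below is adapted verbatim from the in-tree
`Torus.IsGlobalLerayHopf.exists_forall_integral_norm_sq_le_of_hasZeroMean`
(`Literature/Analysis/FluidPDE/LerayHopfUniformEnergyMomentum.lean`), re-proved here from its
(built) imports because that module is not yet rebuilt on the farm.

References: C. Foias, O. Manley, R. Rosa, R. Temam, *Navier–Stokes Equations and Turbulence*
(CUP 2001), Ch. II App. A (A.38)–(A.42), Ch. IV §3.1 (3.2); C. R. Doering, J. D. Gibbon,
*Applied Analysis of the Navier–Stokes Equations* (CUP 1995), (5.3.38)–(5.3.39); R. Temam,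
*Infinite-Dimensional Dynamical Systems in Mechanics and Physics* (Springer 1997), Ch. III §2.2.
-/

set_option linter.dupNamespace false

noncomputable section

open MeasureTheory Filter Set
open scoped InnerProductSpace RealInnerProductSpace ENNReal
open Literature.Analysis.FunctionSpaces Literature.Analysis.FunctionSpaces.Torus
open Literature.Analysis.FluidPDE Literature.Analysis.FluidPDE.Torus

namespace Summit.AnomalousDissipation.AnomalousDissipation.Theorems.BoundedEnergyNoLeakGrid

/-- Local notation (verbatim from the lead's skeleton): the torus `T³`. -/
local notation "𝕋³" => UnitAddTorus (Fin 3)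
/-- Local notation (verbatim from the lead's skeleton): velocity values. -/
local notation "E³" => EuclideanSpace ℝ (Fin 3)

/-- **The trajectory is bounded in `L²` uniformly in time, any momentum** (FMRT 2001,
(3.2)/(A.42), qualitative form): for a global Leray–Hopf solution on `T^d` with viscosity `ν > 0`
and steady mean-zero force `F ∈ L²`, there is `R` with `∫ ‖u(t)‖² ≤ R` for every `t ≥ 0`. The
momentum `m = ∫u(τ)` is conserved for `τ > 0`; Poincaré with mean gives
`∫_{(s,t]} ‖u‖² ≤ ∫ₛᵗ ‖∇u‖² + ‖m‖²(t - s)`, so the processed energy inequalities from `0` and from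
a.e. `s > 0` yield the restarted integral inequality `y(t) + ν ∫_{(s,t]} y ≤ y(s) + C(t - s)`
with `C = ‖F‖₂²/ν + ν‖m‖²`, to which `exists_forall_le_of_restart` applies. Adapted verbatim
from `Torus.IsGlobalLerayHopf.exists_forall_integral_norm_sq_le_of_hasZeroMean`
(`Literature/Analysis/FluidPDE/LerayHopfUniformEnergyMomentum.lean`). [folklore] -/
private theorem exists_forall_integral_norm_sq_le {d : Type*} [Fintype d] [DecidableEq d]
    {ν : ℝ} {F u₀ : UnitAddTorus d → EuclideanSpace ℝ d}
    {u : ℝ → UnitAddTorus d → EuclideanSpace ℝ d} (hν : 0 < ν) (hF : MemLp F 2 volume)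
    (hF0 : HasZeroMean F) (hu : IsGlobalLerayHopf ν (fun _ => F) u₀ u) :
    ∃ R : ℝ, ∀ t, 0 ≤ t → ∫ x, ‖u t x‖ ^ 2 ≤ R := by
  -- adapted from Literature/Analysis/FluidPDE/LerayHopfUniformEnergyMomentum.lean
  classical
  set m : EuclideanSpace ℝ d := ∫ x, u 1 x with hm
  set C₀ : ℝ := (∫ x, ‖F x‖ ^ 2) / ν with hC₀
  have hC₀0 : 0 ≤ C₀ := div_nonneg (integral_nonneg fun x => sq_nonneg _) hν.le
  set C : ℝ := C₀ + ν * ‖m‖ ^ 2 with hC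
  have hC0 : 0 ≤ C := add_nonneg hC₀0 (by positivity)
  set E₀ : ℝ := 2 * kineticEnergy u₀ with hE₀
  have hE₀0 : 0 ≤ E₀ := mul_nonneg zero_le_two (kineticEnergy_nonneg _)
  -- the energy with `y 0` read as `|u₀|²`
  set y : ℝ → ℝ := fun t => if t = 0 then E₀ else ∫ x, ‖u t x‖ ^ 2 with hy
  have hy_of_pos : ∀ t, 0 < t → y t = ∫ x, ‖u t x‖ ^ 2 := fun t ht => by simp [hy, ht.ne']
  have hy0 : ∀ t, 0 ≤ y t := fun t => by
    by_cases ht : t = 0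
    · simp [hy, ht, hE₀0]
    · simp only [hy, ht, if_false]; exact integral_nonneg fun x => sq_nonneg _
  have hyI : ∀ s t, 0 ≤ s → ∫ τ in Ioc s t, y τ = ∫ τ in Ioc s t, (∫ x, ‖u τ x‖ ^ 2) :=
    fun s t hs => setIntegral_congr_fun measurableSet_Ioc fun τ hτ => hy_of_pos τ (hs.trans_lt hτ.1)
  have hyi : ∀ T, IntegrableOn y (Ioc 0 T) := by
    intro T
    rcases le_or_gt T 0 with hT | hT
    · rw [Ioc_eq_empty (not_lt.2 hT)]
      exact integrableOn_empty
    · exact (hu.integrableOn_integral_norm_sq hT).congr_fun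
        (fun τ hτ => (hy_of_pos τ hτ.1).symm) measurableSet_Ioc
  -- Poincaré with mean, integrated in time: `∫_{(s,t]} |u|² ≤ D(s,t) + ‖m‖²(t-s)`
  have hP : ∀ s t, 0 ≤ s → s ≤ t →
      ∫ τ in Ioc s t, (∫ x, ‖u τ x‖ ^ 2) ≤
        (∫⁻ τ in Ioo s t, eGradNormSq (u τ)).toReal + ‖m‖ ^ 2 * (t - s) := by
    intro s t hs hst
    have hLH := hu (t + 1) (by linarith)
    have hsub : Ioo s t ⊆ Ioo 0 (t + 1) := Ioo_subset_Ioo hs (by linarith)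
    have hmeas : AEMeasurable (fun τ => eGradNormSq (u τ)) (volume.restrict (Ioo s t)) :=
      hLH.aemeasurable_eGradNormSq.mono_measure (Measure.restrict_mono hsub le_rfl)
    have hfin : ∫⁻ τ in Ioo s t, eGradNormSq (u τ) < ⊤ :=
      (lintegral_mono_set hsub).trans_lt hLH.lintegral_eGradNormSq_lt_top
    have hlt : ∀ᵐ τ ∂(volume.restrict (Ioo s t)), eGradNormSq (u τ) < ⊤ :=
      ae_lt_top' hmeas hfin.ne
    have hyi' : IntegrableOn (fun τ => ∫ x, ‖u τ x‖ ^ 2) (Ioo s t) := by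
      rcases eq_or_lt_of_le (hs.trans hst) with ht0 | ht0
      · have : Ioo s t = ∅ := Ioo_eq_empty (by rw [← ht0]; exact not_lt.2 hs)
        rw [this]; exact integrableOn_empty
      · exact ((hu.integrableOn_integral_norm_sq ht0).mono_set
          (Ioc_subset_Ioc_left hs)).mono_set Ioo_subset_Ioc_self
    rw [setIntegral_congr_set (Ioo_ae_eq_Ioc (μ := volume) (a := s) (b := t)).symm,
      ← integral_toReal hmeas hlt]
    have hci : IntegrableOn (fun _ : ℝ => ‖m‖ ^ 2) (Ioo s t) :=
      integrableOn_const (hs := measure_Ioo_lt_top.ne)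
    have hsum : (∫ τ in Ioo s t, (eGradNormSq (u τ)).toReal) + ‖m‖ ^ 2 * (t - s) =
        ∫ τ in Ioo s t, ((eGradNormSq (u τ)).toReal + ‖m‖ ^ 2) := by
      rw [integral_add (integrable_toReal_of_lintegral_ne_top hmeas hfin.ne) hci, setIntegral_const,
        Real.volume_real_Ioo_of_le hst, smul_eq_mul, mul_comm]
    rw [hsum]
    refine integral_mono_ae hyi' ((integrable_toReal_of_lintegral_ne_top hmeas hfin.ne).add hci) ?_
    filter_upwards [hlt, ae_restrict_mem measurableSet_Ioo] with τ hτ hτm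
    have hτ0 : 0 < τ := hs.trans_lt hτm.1
    have hmom : ∫ x, u τ x = m := hu.integral_eq_integral_of_hasZeroMean hF hF0 one_pos hτ0
    have h := integral_norm_sq_le_add_toReal_eGradNormSq (hu.memLp_two hτ0.le) hτ.ne
    rw [hmom] at h
    linarith
  -- the good initial times
  set G : Set ℝ := {s | 0 ≤ s ∧ ∀ t, s ≤ t → y t + ν * ∫ τ in Ioc s t, y τ ≤ y s + C * (t - s)}
    with hG
  have h0 : (0 : ℝ) ∈ G := by
    refine ⟨le_rfl, fun t ht => ?_⟩
    rcases eq_or_lt_of_le ht with ht0 | ht0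
    · subst ht0; simp
    · have hE := (hu (t + 1) (by linarith)).energy_ineq_zero t ⟨ht, by linarith⟩
      have h := hu.norm_sq_add_dissipation_le_of_hasZeroMean hν hF hF0 le_rfl ht hE
      have hPt := hP 0 t le_rfl ht
      rw [hyI 0 t le_rfl, hy_of_pos t ht0]
      have hy00 : y 0 = E₀ := by simp [hy]
      rw [hy00]
      rw [sub_zero] at h hPt
      nlinarith [hν, h, hPt, sq_nonneg ‖m‖]
  have hG' : ∀ᵐ s ∂volume, 0 < s → s ∈ G := by
    have hn : ∀ n : ℕ, ∀ᵐ s ∂volume, s ∈ Ioo (0 : ℝ) (n + 1) → ∀ t ∈ Icc s ((n : ℝ) + 1),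
        kineticEnergy (u t) + ν * (∫⁻ τ in Ioo s t, eGradNormSq (u τ)).toReal ≤
          kineticEnergy (u s) + ∫ τ in s..t, ∫ x, ⟪F x, u τ x⟫ := fun n =>
      (ae_restrict_iff' measurableSet_Ioo).1 (hu ((n : ℝ) + 1) (by positivity)).energy_ineq_ae
    rw [← ae_all_iff] at hn
    filter_upwards [hn] with s hs hs0
    refine ⟨hs0.le, fun t hst => ?_⟩
    obtain ⟨n, hn'⟩ := exists_nat_gt t
    have hE := hs n ⟨hs0, by linarith⟩ t ⟨hst, by linarith⟩
    have h := hu.norm_sq_add_dissipation_le_of_hasZeroMean hν hF hF0 hs0.le hst hE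
    have hPt := hP s t hs0.le hst
    rw [hyI s t hs0.le, hy_of_pos t (hs0.trans_le hst), hy_of_pos s hs0]
    have hkin : kineticEnergy (u s) = 2⁻¹ * ∫ x, ‖u s x‖ ^ 2 := rfl
    rw [hkin] at h
    nlinarith [hν, h, hPt, sq_nonneg ‖m‖]
  obtain ⟨R, hR⟩ := exists_forall_le_of_restart hν hC0 hy0 hyi (fun s hs => hs.1) h0 hG'
    (fun s hs t hst => hs.2 t hst)
  refine ⟨R, fun t ht => ?_⟩
  rcases eq_or_lt_of_le ht with ht0 | ht0
  · subst ht0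
    have hE := (hu 1 one_pos).energy_ineq_zero 0 ⟨le_rfl, zero_le_one⟩
    rw [intervalIntegral.integral_same, add_zero] at hE
    have hD : 0 ≤ ν * (∫⁻ τ in Ioo (0 : ℝ) 0, eGradNormSq (u τ)).toReal :=
      mul_nonneg hν.le ENNReal.toReal_nonneg
    have hkin : kineticEnergy (u 0) = 2⁻¹ * ∫ x, ‖u 0 x‖ ^ 2 := rfl
    have hkin0 : kineticEnergy u₀ = 2⁻¹ * E₀ := by rw [hE₀]; ring
    have hR0 := hR 0 le_rfl
    have hy00 : y 0 = E₀ := by simp [hy]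
    rw [hy00] at hR0
    rw [hkin, hkin0] at hE
    linarith
  · rw [← hy_of_pos t ht0]
    exact hR t ht

/-- **stub_absorbingBallGrid** (registered stub of the line `Sketch`, crux
`ImpulseGrid.BoundedEnergyNoLeakGrid`).  The absorbing ball / forward kinetic-energy cap of one
global Leray–Hopf solution on `T³` at fixed viscosity `ν > 0` under a smooth mean-zero steady force
`f`: `∃ C ≥ 0, ∀ t ≥ 0, ½‖u(t)‖₂² ≤ C` (Foias–Manley–Rosa–Temam 2001, App. II.A (A.41)–(A.42),
qualitative, any momentum; Doering–Gibbon 1995, (5.3.38)–(5.3.39)).  From the trajectory bound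
`exists_forall_integral_norm_sq_le` (`∫‖u(t)‖² ≤ R` for `t ≥ 0`, steady mean-zero `L²` force)
with `F := f ∈ L²` (`IsSmooth.memLp`) and `C := max (R/2) 0`. [folklore] -/
theorem stub_absorbingBallGrid :
    ∀ (ν : ℝ) (f : 𝕋³ → E³) (u₀ : 𝕋³ → E³) (u : ℝ → 𝕋³ → E³),
    0 < ν → IsSmooth f → HasZeroMean f → IsGlobalLerayHopf ν (fun _ => f) u₀ u →
    ∃ C : ℝ, 0 ≤ C ∧ ∀ t : ℝ, 0 ≤ t → kineticEnergy (u t) ≤ C := by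
  intro ν f u₀ u hν hf hf0 hu
  obtain ⟨R, hR⟩ := exists_forall_integral_norm_sq_le hν (hf.memLp 2) hf0 hu
  refine ⟨max (R / 2) 0, le_max_right _ _, fun t ht => ?_⟩
  have h := hR t ht
  have hkin : kineticEnergy (u t) = 2⁻¹ * ∫ x, ‖u t x‖ ^ 2 := rfl
  rw [hkin]
  exact le_trans (by linarith) (le_max_left _ _)

end Summit.AnomalousDissipation.AnomalousDissipation.Theorems.BoundedEnergyNoLeakGrid

end
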